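import Summits.BirchSwinnertonDyer.BirchSwinnertonDyer.Theorems.AlignedTransportAtTwoMainConjectureOfRankZeroBSDAtTwoSexticCriterion
import Summits.BirchSwinnertonDyer.BirchSwinnertonDyer.Theorems.AlignedTransportAtTwoMainConjectureOfRankZeroBSDAtTwoStubLimUpstairsDoorAtTwo
import Summits.BirchSwinnertonDyer.BirchSwinnertonDyer.Theorems.ByReductionTypeAtTwoOrdKatoHalfAtTwoIsoRelaxedGenuineOptimal
import Summits.BirchSwinnertonDyer.BirchSwinnertonDyer.Theorems.ByReductionTypeAtTwoAnalyticMuZeroAtTwoHolds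
import Literature.NumberTheory.EllipticCurves.TwoAdicImageSurjectivityModTwoProofs
import HarnessLib

/-!
# Route `AlignedTransportAtTwo`, crux C2 `MainConjectureOfRankZeroBSDAtTwo` (stmt-BirchSwinnertonDyer-22298): the `Δ ∈ ℚ²` TWIN of the
# seed cell — on the `C₃`-image cell the netted road (b″) runs MODULO PRINT + MuIneqʳ ONLY (Ferrero–Washington supplies PFμ⁺)

HONEST FRAMING (cell `bsd-f1-sign2`, WIDTH-5 attached prover seat `bsd-line-att-p5` gen 23 on line `birth` of the lead `bsd-line-att-p2`;
`--supports` stmt-BirchSwinnertonDyer-22298 as a helper, closes nothing; BSD is NOT proved by any of this; the crux C2 (whose seed cell has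
`Δ_W ∉ ℚ²`) is untouched — this file treats the COMPLEMENTARY cell). THEOREMS ONLY — no definition, no named fact, no `sorry`; the published
inputs are DISPLAYED hypotheses: Kato 17.4 (1)(2) at `2`, Greenberg 4.1, the period unit, modularity, GZK (stub P's five), Kato's `μ`-inequality at
`2` against the relaxed-at-`∞` fine dual (`hI` = registered stub MuIneqʳ of line `birth`, VERBATIM; print pending typing) and Ferrero–Washington
(`IwasawaTheory.ferreroWashington1979_classicalMuVanishes`).

WHY. The registered road (b″) reads «P + LimDoor + MuIneqʳ + PFμ⁺ ⟹ crux», PFμ⁺ = Iwasawa's `μ₂ = 0` for the cyclotomic `ℤ₂`-extensions of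
`ℚ(W[2], √−1)`, OPEN on the seed cell because there `ρ̄_{W,2}` is onto (`S₃`; the field is non-abelian). On the twin cell — no rational `2`-torsion
abscissa but `Δ_W ∈ ℚ²` (image `C₃`) — `ρ̄_{W,2}` is NOT onto (Dokchitser–Dokchitser, tree `hasSurjectiveModNGaloisRep_two_iff`), so `ℚ(W[2])/ℚ`
is abelian, so is `ℚ(W[2], i)`, and Ferrero–Washington gives PFμ⁺ there — assembled by cell bsd-2adic (w2 GEN 5 `…RelaxedGenuineOptimal`
§2: `lengthAt_fineRelaxed_eq_zero_of_not_hasSurjectiveModNGaloisRep_of_limUpstairs_of_FW`, relaxed (A₂) from FW + the Lim 2017 upstairs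
door, the latter now the tree theorem p716773); the analytic-`μ` binder is a tree theorem on «no rational `2`-torsion abscissa»
(`AnalyticMuTwo.red_ne_zero_of_isEvenBranchLiftAtTwo_of_forall_not_hasRationalTwoTorsionX`, tower-1 g24 / p641779). Hence:

* `not_hasSurjectiveModNGaloisRep_two_of_isSquare` — `Δ_W ∈ ℚ²` ⟹ `ρ̄_{W,2}` not onto (Dokchitser–Dokchitser); the relaxed (A₂)
  `ℓ₍₂₎(X₀^{rel∞}) = 0` at such `W` is then bsd-2adic's `lengthAt_fineRelaxed_eq_zero_of_not_hasSurjectiveModNGaloisRep_of_limUpstairs_of_FW`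
  (w2 GEN 5, `…RelaxedGenuineOptimal` §2) with its Lim binder DISCHARGED by `Lim2017.…_holds` (p716773) — PFμ⁺'s content is PRINT on this cell.
* **`mazurMainConjecture_two_of_muIneqRel_of_isSquare`** — PRINT⁵ + MuIneqʳ + Ferrero–Washington ⟹ `MC₂(W)` for every `W` good ordinary at
  `2`, no rational `2`-torsion abscissa, `Δ_W ∈ ℚ²`, `r_an = 0`, `BSD₂(W)` (no analytic-`μ` binder, no CM binder).
* **`mainConjectureOfRankZero_squareDisc_of_muIneqRel`** — the cell statement: the `Δ ∈ ℚ²` twin of C2 holds modulo PRINT⁶ + MuIneqʳ.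

LEDGER READING (director / planner-of-record; PARTITION currency): on the rank-`0`, good-ordinary-at-`2`, `C₃`-image cell the converse
«BSD₂ ⟹ MC₂» carries NO open classical-`μ₂` input — only Kato's `μ`-inequality reading at `2` (MuIneqʳ) beyond named print facts. Cell
bsd-2adic's B7′ (stmt-23921, habitat «`ρ̄₂` not onto») reads the same cell through its Coleman `μ`-package; the two readings are independent.
Nothing is closed; BSD is not proved.

References: [FerreroWashington1979] Theorem; [DokchitserDokchitserMathZ2012] Theorem (1); [Lim2017FineSelmer] §3 Thm. 3.5, Lemma 3.2;
[Kato2004Asterisque] Thm. 17.4, Prop. 17.11, §17.13; [GreenbergLNM1716] Conj. 1.11, Thm. 4.1, Lemma 4.6; tree p583329 (Seed), p724543 (LimDoor),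
p641779 (analytic `μ₂ = 0`), bsd-2adic `…AdditiveKatoFineConjAAbelianTwoDivision` / `…FineSelmerConjAAtTwoAdditivePotGoodHeart`.
-/

set_option linter.dupNamespace false
set_option autoImplicit false

noncomputable section

open scoped Classical

namespace Summit.BirchSwinnertonDyer.BirchSwinnertonDyer.Theorems.AlignedTransportAtTwoSquareDiscTwin

open CongruenceSubgroup WeierstrassCurve Field Literature.NumberTheory.EllipticCurves
  Literature.NumberTheory.EllipticCurves.ModularForms
  Literature.NumberTheory.EllipticCurves.Rank1Residual
  Literature.NumberTheory.EllipticCurves.Greenberg1999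
  Literature.NumberTheory.EllipticCurves.Module
  Literature.NumberTheory.GaloisRepresentations
  Literature.NumberTheory.IwasawaTheory
  Summit.BirchSwinnertonDyer.Rank1Residual
  Summit.BirchSwinnertonDyer.Rank1Residual.X1.MuLambda
  Summit.BirchSwinnertonDyer.Rank1Residual.X5
  Summit.BirchSwinnertonDyer.Rank1Residual.F1Sign2
  Summit.BirchSwinnertonDyer.BirchSwinnertonDyer.Theorems.Rank1ResidualX1Defs
  Summit.BirchSwinnertonDyer.BirchSwinnertonDyer.Theses.AlignedTransportAtTwo

section PerCurve

variable (W : WeierstrassCurve ℚ) [W.IsElliptic] [W.IsGloballyMinimal]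

omit [W.IsGloballyMinimal] in
/-- `Δ_W ∈ ℚ²` ⟹ `ρ̄_{W,2}` is NOT onto `GL₂(𝔽₂)` (Dokchitser–Dokchitser: onto ⟺ no rational point of order `2` and `Δ ∉ ℚ²`; tree theorem
`hasSurjectiveModNGaloisRep_two_iff`). [cite: DokchitserDokchitserMathZ2012, Theorem (1)] -/
theorem not_hasSurjectiveModNGaloisRep_two_of_isSquare (hsq : IsSquare W.Δ) : ¬ W.HasSurjectiveModNGaloisRep 2 :=
  fun hs => ((hasSurjectiveModNGaloisRep_two_iff W).mp hs).2 hsq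

/-- **The `Δ ∈ ℚ²` twin, per curve: PRINT⁵ + MuIneqʳ + Ferrero–Washington ⟹ `MC₂(W)`.** For `W/ℚ` (globally minimal) good ordinary at `2`
with no rational `2`-torsion abscissa, `Δ_W ∈ ℚ²`, `r_an = 0` and `BSD₂(W)`: Mazur's `2`-adic main conjecture for `W`, granted Kato 17.4 (1)(2)
at `2` for `W` (`h17`), Greenberg 4.1 (`hGr`), the period unit (`hper`), modularity (`hmod`), GZK (`hGZK`), Kato's `μ`-inequality at `2` against
the relaxed fine dual (`hI` = stub MuIneqʳ verbatim) and Ferrero–Washington (`hFW`). Per cyclotomic datum: the relaxed (A₂) `ℓ₍₂₎(X₀^{rel∞}) = 0`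
is bsd-2adic's `lengthAt_fineRelaxed_eq_zero_of_not_hasSurjectiveModNGaloisRep_of_limUpstairs_of_FW` with the Lim binder discharged by
`Lim2017.…_holds`; the analytic binder `red G₊ ≠ 0` is the tree theorem
`AnalyticMuTwo.red_ne_zero_of_isEvenBranchLiftAtTwo_of_forall_not_hasRationalTwoTorsionX`; then `ℓ₍₂₎(X) ≤ 0 + 0`
(att-p3 g2 `lengthAt_eq_zero_of_muInequality`) and p583329's engine. No CM binder, no analytic-`μ` binder, no open classical input.
[cite: Kato2004Asterisque, Thm. 17.4 (1)(2) (p. 273) and §17.13 (pp. 279–280)] [cite: FerreroWashington1979, Theorem]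
[cite: GreenbergLNM1716, Thm. 4.1 (p. 102), Lemma 4.6 and Conj. 1.11 (p. 58)] [cite: Lim2017FineSelmer, §3 Thm. 3.5 and Lemma 3.2] -/
theorem mazurMainConjecture_two_of_muIneqRel_of_isSquare
    (h17 : ∀ [NeZero (W.conductorNorm ℤ)] (f : CuspForm (Gamma0 (W.conductorNorm ℤ)) 2),
      kato_divisibility_allPrimes W 2 (f := f))
    (hGr : Greenberg1999.thm41_charValue_rankZero_anyPrime)
    (hper : realPeriodRat_eq_unit_mul_plusPeriod_two) (hmod : nonempty_modularParametrizationData)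
    (hGZK : rank_eq_analyticRank_of_analyticRank_le_one)
    (hI : ∀ (W : WeierstrassCurve ℚ) [W.IsElliptic] [W.IsGloballyMinimal], IsOrdinaryAt W 2 →
      (∀ x : ℚ, ¬ HasRationalTwoTorsionX W x) →
      ∀ (κ : ZpExtension ℚ 2) (γ : Field.absoluteGaloisGroup ℚ), κ.IsCyclotomic →
      κ.IsTopGenerator γ → IsCyclotomicVariable 2 γ →
      ∀ ⦃N : ℕ⦄ [NeZero N] (f : CuspForm (Gamma0 N) 2), IsNewformOf W f →
      ∀ Gp : IwasawaAlgebra 2, iwasawaToPowerSeries 2 Gp = padicLFunction f (unitRoot W 2 : ℚ_[2]) →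
      ∀ (D : W.SelmerDualData κ γ) (Yr : W.FineSelmerDualDataRelaxedInf κ γ),
        lengthAt (IwasawaAlgebra 2) D.X ⟨IwasawaAlgebra.augIdealP 2, IwasawaAlgebra.isPrime_augIdealP_holds 2⟩ ≤
          lengthAt (IwasawaAlgebra 2) (IwasawaAlgebra 2 ⧸ Ideal.span {Gp})
              ⟨IwasawaAlgebra.augIdealP 2, IwasawaAlgebra.isPrime_augIdealP_holds 2⟩ +
            lengthAt (IwasawaAlgebra 2) Yr.X ⟨IwasawaAlgebra.augIdealP 2, IwasawaAlgebra.isPrime_augIdealP_holds 2⟩)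
    (hFW : ferreroWashington1979_classicalMuVanishes)
    (hord : IsOrdinaryAt W 2) (ht : ∀ x : ℚ, ¬ HasRationalTwoTorsionX W x) (hsq : IsSquare W.Δ)
    (hr : W.analyticRank = 0) (hbsd : BSDp W 2) :
    MazurMainConjecture W 2 := by
  have hns := not_hasSurjectiveModNGaloisRep_two_of_isSquare W hsq
  have hμan := AnalyticMuTwo.red_ne_zero_of_isEvenBranchLiftAtTwo_of_forall_not_hasRationalTwoTorsionX W hord ht
  refine AlignedTransportAtTwoSeed.mazurMainConjecture_two_of_bsdp_of_mu_eq_zero W h17 hGr hper hmod hGZK hord ht hr hbsd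
    fun κ γ hκ hγ hγ' D _ => ?_
  let 𝔭 : PrimeSpectrum (IwasawaAlgebra 2) :=
    ⟨IwasawaAlgebra.augIdealP 2, IwasawaAlgebra.isPrime_augIdealP_holds 2⟩
  have hirr : Irr W 2 := AlignedTransportAtTwoSeed.irr_two_of_forall_not_hasRationalTwoTorsionX W ht
  haveI : NeZero (W.conductorNorm ℤ) := ⟨(W.conductorNorm_pos_holds).ne'⟩
  obtain ⟨Dm⟩ := hmod W
  obtain ⟨Gp, hGp⟩ := exists_iwasawaToPowerSeries_eq_padicLFunction_two hord Dm.isNewformOf hirr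
  have hred : red Gp ≠ 0 := hμan Dm.f Dm.isNewformOf Gp (Or.inl ⟨hord, hGp⟩)
  let Yr : W.FineSelmerDualDataRelaxedInf κ γ := W.fineSelmerDualDataRelaxedInf κ hγ
  have hY : lengthAt (IwasawaAlgebra 2) Yr.X 𝔭 = 0 :=
    SteinbergFibreAtTwo.lengthAt_fineRelaxed_eq_zero_of_not_hasSurjectiveModNGaloisRep_of_limUpstairs_of_FW
      Lim2017.thm35_at_two_upstairs_fineSelmer_twoTorsion_finite_of_classicalMuVanishes_holds hFW W hns hκ hγ Yr
  have hle := hI W hord ht κ γ hκ hγ hγ' Dm.f Dm.isNewformOf Gp hGp D Yr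
  have hX0 : lengthAt (IwasawaAlgebra 2) D.X 𝔭 = 0 :=
    AlignedTransportAtTwoFineRoad.lengthAt_eq_zero_of_muInequality 2 𝔭 rfl hred hY hle
  change muInvariant 2 D.X = 0
  rw [muInvariant_eq_toNat_lengthAt 2 D.X 𝔭 rfl, hX0]
  rfl

end PerCurve

/-- **THE `Δ ∈ ℚ²` TWIN OF C2, modulo PRINT⁶ + MuIneqʳ.** Granted Kato 17.4 (1)(2) at `2` (`h17`, every curve), Greenberg 4.1, the period
unit, modularity, GZK, Ferrero–Washington — six named PRINT facts — and Kato's `μ`-inequality at `2` against the relaxed fine dual (`hI` =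
registered stub MuIneqʳ of line `birth`, print pending typing): for EVERY globally minimal `W/ℚ` good ordinary at `2` with no rational
`2`-torsion abscissa, `Δ_W ∈ ℚ²` (image of `ρ̄_{W,2}` = `C₃`), analytic rank `0` and `BSD₂(W)`, Mazur's `2`-adic main conjecture holds.
The statement is C2's body with `¬ IsSquare W.Δ` replaced by `IsSquare W.Δ` and the CM and analytic-`μ` binders dropped. CONDITIONAL on
the displayed hypotheses (no open classical-`μ₂` input on this cell); nothing is closed; BSD is not proved by any of this.
[cite: Kato2004Asterisque, Thm. 17.4 (p. 273) and §17.13 (pp. 279–280)] [cite: FerreroWashington1979, Theorem]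
[cite: GreenbergLNM1716, Thm. 4.1 (p. 102) and Conj. 1.11 (p. 58)] [cite: DokchitserDokchitserMathZ2012, Theorem (1)] -/
theorem mainConjectureOfRankZero_squareDisc_of_muIneqRel
    (h17 : ∀ (V : WeierstrassCurve ℚ) [V.IsElliptic] [V.IsGloballyMinimal] [NeZero (V.conductorNorm ℤ)]
      (f : CuspForm (Gamma0 (V.conductorNorm ℤ)) 2), kato_divisibility_allPrimes V 2 (f := f))
    (hGr : Greenberg1999.thm41_charValue_rankZero_anyPrime)
    (hper : realPeriodRat_eq_unit_mul_plusPeriod_two) (hmod : nonempty_modularParametrizationData)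
    (hGZK : rank_eq_analyticRank_of_analyticRank_le_one)
    (hFW : ferreroWashington1979_classicalMuVanishes)
    (hI : ∀ (W : WeierstrassCurve ℚ) [W.IsElliptic] [W.IsGloballyMinimal], IsOrdinaryAt W 2 →
      (∀ x : ℚ, ¬ HasRationalTwoTorsionX W x) →
      ∀ (κ : ZpExtension ℚ 2) (γ : Field.absoluteGaloisGroup ℚ), κ.IsCyclotomic →
      κ.IsTopGenerator γ → IsCyclotomicVariable 2 γ →
      ∀ ⦃N : ℕ⦄ [NeZero N] (f : CuspForm (Gamma0 N) 2), IsNewformOf W f →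
      ∀ Gp : IwasawaAlgebra 2, iwasawaToPowerSeries 2 Gp = padicLFunction f (unitRoot W 2 : ℚ_[2]) →
      ∀ (D : W.SelmerDualData κ γ) (Yr : W.FineSelmerDualDataRelaxedInf κ γ),
        lengthAt (IwasawaAlgebra 2) D.X ⟨IwasawaAlgebra.augIdealP 2, IwasawaAlgebra.isPrime_augIdealP_holds 2⟩ ≤
          lengthAt (IwasawaAlgebra 2) (IwasawaAlgebra 2 ⧸ Ideal.span {Gp})
              ⟨IwasawaAlgebra.augIdealP 2, IwasawaAlgebra.isPrime_augIdealP_holds 2⟩ +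
            lengthAt (IwasawaAlgebra 2) Yr.X ⟨IwasawaAlgebra.augIdealP 2, IwasawaAlgebra.isPrime_augIdealP_holds 2⟩) :
    ∀ (W : WeierstrassCurve ℚ) [W.IsElliptic] [W.IsGloballyMinimal],
      IsOrdinaryAt W 2 → (∀ x : ℚ, ¬ HasRationalTwoTorsionX W x) → IsSquare W.Δ →
      W.analyticRank = 0 → BSDp W 2 → MazurMainConjecture W 2 :=
  fun W _ _ hord ht hsq hr hbsd =>
    mazurMainConjecture_two_of_muIneqRel_of_isSquare W (fun f => h17 W f) hGr hper hmod hGZK hI hFW hord ht hsq hr hbsd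

end Summit.BirchSwinnertonDyer.BirchSwinnertonDyer.Theorems.AlignedTransportAtTwoSquareDiscTwin

end
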